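import Summits.HubbardSuperconductivity.HubbardSuperconductivity.Theorems.BalabanIRBirComplexStableXYRSmoothedBoxPartition
import Literature.MathematicalPhysics.QuantumFieldTheory.VillainAngleForm
import HarnessLib

/-!
# Crux `BirComplexStableXYR` (stmt-HubbardSuperconductivity-14845), line `log-concave-core-bounded-phase`:
# the exact smoothed-box lift identity (stub S1, `stub_liftIdentity`)

Support file for the restated engine `…Theses.BalabanIR.BirComplexStableXYR`.  On the space-time
torus `Λ = TorusSite 2 L × ZMod M` with the `3|Λ|` unit-step bonds `b = (p, i)` (steps
`e₀ = (![1,0],0)`, `e₁ = (![0,1],0)`, `e₂ = (0,1)`), inserting for every bond the smoothed-box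
partition of unity `1 = Σ_{n_b ∈ ℤ} χ_v(θ(p + e_i) − θ(p) − 2π n_b)`
(`χ_v(u) = ∫_{[-π,π]} g_v(u − t) dt`, the landed `smoothedBox_hasSum`) and exchanging the sum over
integer bond fields `n : Λ × Fin 3 → ℤ` with the torus integral gives, for every continuous `g`,
`HasSum (n ↦ ∫_{[0,2π]^Λ} g(θ) Π_b χ_v(∇_bθ − 2πn_b) dθ) (∫_{[0,2π]^Λ} g(θ) dθ)`.

* `hasSum_pi_prod_one` — `Π_i Σ_n f_i(n) = 1` as a `HasSum` over `ι → ℤ` for non-negative `f_i`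
  with `HasSum f_i 1` (Tonelli on `ℤ^ι`, the tree's `VillainAngle.tsum_pi_prod_real`);
* `hasSum_integral_mul_prod` — the abstract dominated exchange of `Σ_n` and `∫`
  (`hasSum_integral_of_dominated_convergence`, bound `‖g‖ · Π_i F_i`);
* `continuous_smoothedBox` — `s ↦ χ_v(s − 2πn)` is continuous (parametric interval integral);
* `lccb_liftIdentity` — the registered stub signature. [folklore]
-/

noncomputable section

namespace Summit.HubbardSuperconductivity.HubbardSuperconductivity.Theorems

open MeasureTheory

section LiftIdentity

/-- Tonelli on `ℤ^ι` for a product of partitions of unity: if every `f i ≥ 0` has `HasSum (f i) 1`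
then `HasSum (m ↦ Π_i f i (m i)) 1` over `ι → ℤ`. [folklore] -/
theorem hasSum_pi_prod_one {ι : Type*} [Fintype ι] (f : ι → ℤ → ℝ) (hf : ∀ i l, 0 ≤ f i l)
    (hs : ∀ i, HasSum (f i) 1) : HasSum (fun m : ι → ℤ => ∏ i, f i (m i)) 1 := by
  obtain ⟨hsum, heq⟩ :=
    Literature.MathematicalPhysics.QuantumFieldTheory.VillainAngle.tsum_pi_prod_real f hf
      fun i => (hs i).summable
  have h1 : ∏ i, ∑' l, f i l = (1 : ℝ) := Finset.prod_eq_one fun i _ => (hs i).tsum_eq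
  rw [← h1, ← heq]
  exact hsum.hasSum

/-- Dominated exchange of the sum over integer fields and the integral: for non-negative measurable
selectors `F i n` with `Σ_n F i n = 1` pointwise and an integrable `g`,
`HasSum (m ↦ ∫ g · Π_i F i (m i)) (∫ g)`. [folklore] -/
theorem hasSum_integral_mul_prod {ι : Type*} [Fintype ι] {α : Type*} [MeasurableSpace α]
    (μ : Measure α) (F : ι → ℤ → α → ℝ) (hF0 : ∀ i n a, 0 ≤ F i n a)
    (hF1 : ∀ i a, HasSum (fun n => F i n a) 1) (hFm : ∀ i n, AEStronglyMeasurable (F i n) μ)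
    (g : α → ℂ) (hg : Integrable g μ) :
    HasSum (fun m : ι → ℤ => ∫ a, g a * ∏ i, ((F i (m i) a : ℝ) : ℂ) ∂μ) (∫ a, g a ∂μ) := by
  have hpt : ∀ a, HasSum (fun m : ι → ℤ => ∏ i, F i (m i) a) 1 := fun a =>
    hasSum_pi_prod_one (fun i n => F i n a) (fun i n => hF0 i n a) fun i => hF1 i a
  refine hasSum_integral_of_dominated_convergence (fun m a => ‖g a‖ * ∏ i, F i (m i) a)
    ?_ ?_ ?_ ?_ ?_
  · intro m
    exact hg.aestronglyMeasurable.fun_mul (Finset.aestronglyMeasurable_fun_prod _ fun i _ =>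
      Complex.continuous_ofReal.comp_aestronglyMeasurable (hFm i (m i)))
  · intro m
    refine Filter.Eventually.of_forall fun a => ?_
    rw [norm_mul, ← Complex.ofReal_prod, Complex.norm_of_nonneg
      (Finset.prod_nonneg fun i _ => hF0 _ _ _)]
  · exact Filter.Eventually.of_forall fun a => ((hpt a).mul_left ‖g a‖).summable
  · have h : (fun a => ∑' m : ι → ℤ, ‖g a‖ * ∏ i, F i (m i) a) = fun a => ‖g a‖ := by
      funext a
      rw [((hpt a).mul_left ‖g a‖).tsum_eq, mul_one]
    rw [h]
    exact hg.norm
  · refine Filter.Eventually.of_forall fun a => ?_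
    have h1 : HasSum (fun m : ι → ℤ => ((∏ i, F i (m i) a : ℝ) : ℂ)) ((1 : ℝ) : ℂ) :=
      Complex.hasSum_ofReal.mpr (hpt a)
    have h2 := h1.mul_left (g a)
    simp only [Complex.ofReal_prod, Complex.ofReal_one, mul_one] at h2
    exact h2

/-- The smoothed box `s ↦ χ_v(s − 2πn) = ∫_{[-π,π]} g_v(s − 2πn − t) dt` is continuous in `s`.
[folklore] -/
theorem continuous_smoothedBox (v : NNReal) (n : ℤ) :
    Continuous fun s : ℝ => ∫ t in Set.Icc (-Real.pi) Real.pi,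
      ProbabilityTheory.gaussianPDFReal 0 v (s - 2 * Real.pi * n - t) := by
  have hg : Continuous (ProbabilityTheory.gaussianPDFReal 0 v) := by
    rw [ProbabilityTheory.gaussianPDFReal_def]
    fun_prop
  have h : (fun s : ℝ => ∫ t in Set.Icc (-Real.pi) Real.pi,
      ProbabilityTheory.gaussianPDFReal 0 v (s - 2 * Real.pi * n - t)) =
      fun s : ℝ => ∫ t in (-Real.pi)..Real.pi,
        ProbabilityTheory.gaussianPDFReal 0 v (s - 2 * Real.pi * n - t) := by
    funext s
    rw [integral_Icc_eq_integral_Ioc, intervalIntegral.integral_of_le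
      (by linarith [Real.pi_pos] : -Real.pi ≤ Real.pi)]
  rw [h]
  exact intervalIntegral.continuous_parametric_intervalIntegral_of_continuous'
    (f := fun s t => ProbabilityTheory.gaussianPDFReal 0 v (s - 2 * Real.pi * n - t))
    (hg.comp (by fun_prop : Continuous fun p : ℝ × ℝ => p.1 - 2 * Real.pi * n - p.2))
    (-Real.pi) Real.pi

/-- **Stub S1 (lift identity)** of the line `log-concave-core-bounded-phase`: the exact
smoothed-box lift of a torus integral to integer bond fields.  For every continuous `g` on
`ℝ^Λ`, inserting `1 = Π_b Σ_{n_b} χ_v(∇_bθ − 2πn_b)` over the `3|Λ|` unit-step bonds and exchanging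
sum and integral (dominated convergence, bound `‖g‖ Π_b χ`),
`Σ_{n : Λ × Fin 3 → ℤ} ∫_{[0,2π]^Λ} g Π_b χ_v(∇_bθ − 2πn_b) = ∫_{[0,2π]^Λ} g` as a `HasSum`. [folklore] -/
theorem lccb_liftIdentity :
    ∀ (L M : ℕ) [NeZero L] [NeZero M] (v : NNReal), v ≠ 0 →
    ∀ g : ((Literature.Probability.LatticeModels.TorusSite 2 L × ZMod M) → ℝ) → ℂ, Continuous g →
    HasSum (fun nb : ((Literature.Probability.LatticeModels.TorusSite 2 L × ZMod M) × Fin 3) → ℤ =>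
        ∫ θ in Set.pi Set.univ (fun _ => Set.Icc (0:ℝ) (2 * Real.pi)),
          g θ * ∏ b : (Literature.Probability.LatticeModels.TorusSite 2 L × ZMod M) × Fin 3,
            ((∫ t in Set.Icc (-Real.pi) Real.pi, ProbabilityTheory.gaussianPDFReal 0 v
              (θ (b.1 + (![((![1, 0] : Literature.Probability.LatticeModels.TorusSite 2 L), (0 : ZMod M)),
                  (![0, 1], 0), (0, 1)] : Fin 3 → Literature.Probability.LatticeModels.TorusSite 2 L × ZMod M) b.2)
                - θ b.1 - 2 * Real.pi * (nb b) - t) : ℝ) : ℂ))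
      (∫ θ in Set.pi Set.univ (fun _ => Set.Icc (0:ℝ) (2 * Real.pi)), g θ) := by
  intro L M _ _ v hv g hg
  have hK : IsCompact (Set.pi Set.univ
      (fun _ : Literature.Probability.LatticeModels.TorusSite 2 L × ZMod M =>
        Set.Icc (0:ℝ) (2 * Real.pi))) :=
    isCompact_univ_pi fun _ => isCompact_Icc
  have hgi : IntegrableOn g (Set.pi Set.univ
      (fun _ : Literature.Probability.LatticeModels.TorusSite 2 L × ZMod M =>
        Set.Icc (0:ℝ) (2 * Real.pi))) :=
    hg.continuousOn.integrableOn_compact hK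
  exact hasSum_integral_mul_prod
    (volume.restrict (Set.pi Set.univ
      (fun _ : Literature.Probability.LatticeModels.TorusSite 2 L × ZMod M =>
        Set.Icc (0:ℝ) (2 * Real.pi))))
    (fun (b : (Literature.Probability.LatticeModels.TorusSite 2 L × ZMod M) × Fin 3) (n : ℤ)
        (θ : (Literature.Probability.LatticeModels.TorusSite 2 L × ZMod M) → ℝ) =>
      ∫ t in Set.Icc (-Real.pi) Real.pi, ProbabilityTheory.gaussianPDFReal 0 v
        (θ (b.1 + (![((![1, 0] : Literature.Probability.LatticeModels.TorusSite 2 L), (0 : ZMod M)),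
            (![0, 1], 0), (0, 1)] : Fin 3 → Literature.Probability.LatticeModels.TorusSite 2 L × ZMod M) b.2)
          - θ b.1 - 2 * Real.pi * n - t))
    (fun b n θ => smoothedBox_nonneg v _ n)
    (fun b θ => smoothedBox_hasSum v hv _)
    (fun b n => ((continuous_smoothedBox v n).comp
      ((continuous_apply (b.1 + (![((![1, 0] : Literature.Probability.LatticeModels.TorusSite 2 L),
          (0 : ZMod M)), (![0, 1], 0), (0, 1)] :
            Fin 3 → Literature.Probability.LatticeModels.TorusSite 2 L × ZMod M) b.2)).sub
        (continuous_apply b.1))).aestronglyMeasurable)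
    g hgi

end LiftIdentity

end Summit.HubbardSuperconductivity.HubbardSuperconductivity.Theorems
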